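import Mathlib
import Summits.ValiantsHypothesis.ValiantsHypothesis.Theses.NumTame
import Summits.ValiantsHypothesis.ValiantsHypothesis.Theorems.NumTameDefs
import Summits.ValiantsHypothesis.ValiantsHypothesis.Theorems.NumTameTameA3Rounding
import Summits.ValiantsHypothesis.ValiantsHypothesis.Theorems.NumTameTameA3StubGates
import HarnessLib

/-!
# Route NumTame — crux `TameA3` (stmt-ValiantsHypothesis-5386) from its two registered stubs

The composition `TameA3_of` of the crux line `Cruxes/TameA3/Lines/birth.lean`, instantiated with the
landed stubs `stub_rounding` (`NumTameTameA3Rounding.lean`, error recursion of the clamped complex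
fixed-point run) and `stub_gates` (`NumTameTameA3StubGates.lean`, polynomial-size `B₂`-circuits for
that run): precision `B n = (2 r n + 2)^{c₁}`, format `(r n + 2, B n)`; Stage 1 (`stub_rounding` +
`FixedPoint.toNat_round_eq`) the run rounds to `φ n x` exactly; Stage 2 (`stub_gates` at width `t n`)
it is a `B₂`-program of size `(s + r n + 2 + B n + t n + 2)^{c₂} ≤ q.eval n` with `q` a polynomial.
The conclusion is literally the route decl `Summit.ValiantsHypothesis.ValiantsHypothesis.Theses.NumTame.TameA3`.

Honest framing: `TameA3` is one crux of the CONDITIONAL route NumTame (Bürgisser's transfer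
`VP = VNP ⇒ NP ⊆ P/poly` made GRH-free for tame circuit families); `VP ≠ VNP` is NOT proved and
nothing here is progress on it.

## References

* P. Bürgisser, *Cook's versus Valiant's hypothesis*, Theoret. Comput. Sci. 235 (2000), §5 (A3).
  [cite: Burgisser2000TCS, §5 (A3)]
-/

set_option linter.dupNamespace false

noncomputable section

namespace Summit.ValiantsHypothesis.ValiantsHypothesis.Theorems.NumTame

open Summit.ValiantsHypothesis.ValiantsHypothesis.Theses.NumTame
open Literature.Computability.AlgebraicComplexity
open Literature.Computability.Complexity (CktSize B2)

/-- **Crux `TameA3` of route NumTame** (archimedean half (A3) of Bürgisser's transfer, GRH-free for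
tame families): if `φ_n : {0,1}^n → ℕ`, `φ_n < 2^{t(n)}` with `t` p-bounded, is computed on the cube
by fan-in-two `ℂ`-circuits of p-bounded size `r(n)` whose constants, sum weights, output constant and
cube values of gates all have modulus `≤ 2^{r(n)}`, then the bits of `φ_n` have polynomial-size
`B₂`-circuits. Composition of the two registered stubs of line `birth` (`stub_rounding`, `stub_gates`)
exactly as in the skeleton's `TameA3_of`. [cite: Burgisser2000TCS, §5 (A3)] -/
theorem tameA3_proof : Summit.ValiantsHypothesis.ValiantsHypothesis.Theses.NumTame.TameA3 := by
  unfold Summit.ValiantsHypothesis.ValiantsHypothesis.Theses.NumTame.TameA3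
  obtain ⟨c₁, hround⟩ := stub_rounding
  obtain ⟨c₂, hgates⟩ := stub_gates
  rintro φ t ht hφ ⟨r, hr, hP⟩
  -- the global size bound, p-bounded in `n`
  have hg : IsPBounded fun n => (r n + (r n + 2) + (r n + r n + 2) ^ c₁ + t n + 2) ^ c₂ :=
    IsPBounded.pow_holds (IsPBounded.add_holds (IsPBounded.add_holds (IsPBounded.add_holds
      (IsPBounded.add_holds hr (IsPBounded.add_holds hr (IsPBounded.const 2)))
      (IsPBounded.pow_holds (IsPBounded.add_holds (IsPBounded.add_holds hr hr) (IsPBounded.const 2)) c₁))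
      ht) (IsPBounded.const 2)) c₂
  obtain ⟨q, hq⟩ := (isPBounded_iff_exists_polynomial_holds _).1 hg
  refine ⟨q, fun n => ?_⟩
  obtain ⟨P, hsize, hfan, hconst, hwt, hout, hval, hcomp⟩ := hP n
  -- precision
  set B : ℕ := (r n + r n + 2) ^ c₁ with hB
  have hprec : (r n + P.size + 2) ^ c₁ ≤ B := Nat.pow_le_pow_left (by omega) _
  -- Stage 1 (stub_rounding): the clamped fixed-point run in format (r n + 2, B) rounds to φ n x
  have hexact : ∀ x : Fin n → Bool, FixedPoint.outNat P (r n + 2) B x = φ n x := fun x => by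
    have h := hround n (r n) B P x hfan hconst hwt hout (fun g hg => hval g hg x) hprec
    rw [hcomp x] at h
    exact FixedPoint.toNat_round_eq h
  -- Stage 2 (stub_gates): that run is a polynomial-size B₂ program
  have hck := hgates n (r n + 2) B (t n) P hfan
  refine CktSize.of_le (hck.congr fun x i => by rw [hexact x]) (le_trans ?_ (hq n))
  exact Nat.pow_le_pow_left (by omega) _

end Summit.ValiantsHypothesis.ValiantsHypothesis.Theorems.NumTame

end
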